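import Mathlib.Analysis.Calculus.Deriv.Shift
import Literature.Probability.RandomPlanarGeometry.WholePlaneLoewnerVolterra
import Literature.Probability.RandomPlanarGeometry.WholePlaneLoewnerDefs
import Literature.Probability.RandomPlanarGeometry.WholePlaneSLEProofs
import HarnessLib

/-!
# The whole-plane Loewner chain: trajectories from `-∞` — existence and uniqueness

Topic `Probability/RandomPlanarGeometry`. Second step of the proof of
`WholePlaneLoewnerChain.exists_unique` (G. F. Lawler, *Conformally Invariant Processes in the
Plane* (2005), §4.3, Prop. 4.21), in the interior picture of `WholePlaneLoewnerDefs`: for a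
continuous driving function `λ` and every `w ∈ ℂ`,

* `kernel_volterraData` — the Volterra kernel `2eᵗm²/(ξₜ - eᵗm)` of the substitution `k = eᵗ m` is
  Volterra data (`WholePlaneLoewnerVolterra`) on `(-∞, T₀] × closedBall 0 (2R)` with constants
  `B = 11R²`, `L = 18R`, as soon as `32 (R + 1) e^{T₀} ≤ 1`;
* `exists_isTraj` — **existence near `-∞`**: `w` has a trajectory with lifetime `T₀` whenever
  `32 (‖w‖ + 1) e^{T₀} ≤ 1` (the Volterra solution `m` started "at `-∞` from `w`", `k = eᵗ m`); so
  `bot_lt_lifetime`, `coe_le_lifetime`;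
* `IsTraj.isVolterraSol` — conversely, along any trajectory `e^{-t} k` solves the Volterra equation
  far enough in the past, whence **uniqueness of trajectories** (`IsTraj.eq_of_isTraj`: two
  trajectories of the same point agree before both lifetimes — Volterra uniqueness near `-∞`, then
  the uniqueness of the radial Loewner flow `RadialLoewner.Disc.IsSolution.eqOn` through the
  bridge `IsTraj.disc_isSolution`);
* `traj_eq`, `isTraj_traj` — the maximal trajectory `traj λ w` is a trajectory with lifetime
  `lifetime λ w` and every trajectory is a restriction of it; `norm_traj_sub_le` — the a priori
  bound `‖e^{-t} traj λ w t - w‖ ≤ 11 ‖w‖² eᵗ`.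

Everything is proved; no named fact is introduced (theorems only). (The named fact itself is
discharged in the *exterior* picture by `WholePlaneLoewnerBackwardChain`
(`WholePlaneLoewnerChain.exists_unique_holds`); this file completes the *interior* API promised by
`WholePlaneLoewnerDefs` — the interior trajectories after a time `T` are the radial Loewner flow in
`𝔻` of Miller–Sheffield (2013), §2.1.3, the picture in which their Prop. 2.5 (continuity of
whole-plane SLE) is proved.)

## References

* G. F. Lawler, *Conformally Invariant Processes in the Plane*, AMS (2005), §4.3, Prop. 4.21
  [Lawler2005].
-/

noncomputable section

open Set Filter Metric Complex
open scoped Topology NNReal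

namespace Literature.Probability.RandomPlanarGeometry

namespace WholePlaneLoewner

variable {lam : ℝ → ℝ}

/-! ### Elementary estimates for the kernel -/

/-- The denominator of the kernel stays away from `0`: `1 - δ ≤ ‖ξₛ - eˢ m‖` if `eˢ ‖m‖ ≤ δ`.
[folklore] -/
theorem sub_le_norm_drivingPt_sub {s : ℝ} {m : ℂ} {δ : ℝ} (h : Real.exp s * ‖m‖ ≤ δ) :
    1 - δ ≤ ‖drivingPt lam s - Real.exp s * m‖ := by
  have h1 := norm_sub_norm_le (drivingPt lam s) ((Real.exp s : ℂ) * m)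
  rw [norm_drivingPt, WholePlaneLoewnerChain.norm_ofReal_exp_mul] at h1
  linarith

/-- The standing smallness condition `32 (R + 1) e^{T₀} ≤ 1` gives `eˢ ‖m‖ ≤ 1/16` for `s ≤ T₀`,
`‖m‖ ≤ 2R`. [folklore] -/
theorem exp_mul_norm_le {R T₀ s : ℝ} {m : ℂ} (hT : 32 * (R + 1) * Real.exp T₀ ≤ 1) (hs : s ≤ T₀)
    (hm : ‖m‖ ≤ 2 * R) : Real.exp s * ‖m‖ ≤ 1 / 16 := by
  have hR : 0 ≤ R := by linarith [norm_nonneg m]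
  have h1 : Real.exp s ≤ Real.exp T₀ := Real.exp_le_exp.2 hs
  have h2 : Real.exp s * ‖m‖ ≤ Real.exp T₀ * (2 * R) :=
    mul_le_mul h1 hm (norm_nonneg _) (Real.exp_pos _).le
  nlinarith [Real.exp_pos T₀]

/-- The difference identity for the kernel:
`G(x) - G(y) = 2eˢ (x - y) (ξ (x + y) - eˢ x y)/((ξ - eˢ x)(ξ - eˢ y))`. [folklore] -/
theorem kernel_sub_kernel {s : ℝ} {x y : ℂ} (hx : drivingPt lam s - Real.exp s * x ≠ 0)
    (hy : drivingPt lam s - Real.exp s * y ≠ 0) :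
    kernel lam s x - kernel lam s y =
      2 * Real.exp s * (x - y) * (drivingPt lam s * (x + y) - Real.exp s * x * y) /
        ((drivingPt lam s - Real.exp s * x) * (drivingPt lam s - Real.exp s * y)) := by
  rw [kernel_apply, kernel_apply, div_sub_div _ _ hx hy,
    div_eq_div_iff (mul_ne_zero hx hy) (mul_ne_zero hx hy)]
  ring

/-- **The kernel is Volterra data** on `(-∞, T₀] × closedBall 0 (2R)` with `B = 11 R²`, `L = 18 R`,
provided `32 (R + 1) e^{T₀} ≤ 1` (continuous driving function). [folklore] -/
theorem kernel_volterraData (hlam : Continuous lam) {R T₀ : ℝ} (hR : 0 ≤ R)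
    (hT : 32 * (R + 1) * Real.exp T₀ ≤ 1) :
    VolterraData T₀ (closedBall (0 : ℂ) (2 * R)) (11 * R ^ 2) (18 * R) (kernel lam) := by
  -- denominators on the set
  have hden : ∀ s ≤ T₀, ∀ x ∈ closedBall (0 : ℂ) (2 * R),
      15 / 16 ≤ ‖drivingPt lam s - Real.exp s * x‖ := by
    intro s hs x hx
    rw [mem_closedBall_zero_iff] at hx
    have := sub_le_norm_drivingPt_sub (lam := lam) (exp_mul_norm_le hT hs hx)
    linarith
  have hden0 : ∀ s ≤ T₀, ∀ x ∈ closedBall (0 : ℂ) (2 * R),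
      drivingPt lam s - Real.exp s * x ≠ 0 := fun s hs x hx h0 ↦ by
    have := hden s hs x hx
    rw [h0, norm_zero] at this
    linarith
  refine ⟨?_, ?_, ?_, by positivity, by positivity⟩
  · -- continuity
    have hξ : Continuous fun p : ℝ × ℂ ↦ drivingPt lam p.1 :=
      (continuous_drivingPt hlam).comp continuous_fst
    have he : Continuous fun p : ℝ × ℂ ↦ (Real.exp p.1 : ℂ) :=
      continuous_ofReal.comp (Real.continuous_exp.comp continuous_fst)
    have hnum : Continuous fun p : ℝ × ℂ ↦ 2 * (Real.exp p.1 : ℂ) * p.2 ^ 2 :=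
      (continuous_const.mul he).mul (continuous_snd.pow 2)
    have hd : Continuous fun p : ℝ × ℂ ↦ drivingPt lam p.1 - Real.exp p.1 * p.2 :=
      hξ.sub (he.mul continuous_snd)
    refine (hnum.continuousOn.div hd.continuousOn ?_).congr fun p _ ↦ rfl
    rintro ⟨s, x⟩ ⟨hs, hx⟩
    exact hden0 s hs x hx
  · -- bound
    intro s hs x hx
    have hx' : ‖x‖ ≤ 2 * R := mem_closedBall_zero_iff.1 hx
    have hd := hden s hs x hx
    rw [kernel_apply, norm_div, div_le_iff₀ (by linarith)]
    have h1 : ‖2 * (Real.exp s : ℂ) * x ^ 2‖ = 2 * Real.exp s * ‖x‖ ^ 2 := by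
      rw [norm_mul, norm_mul, norm_pow, Complex.norm_of_nonneg (Real.exp_pos s).le]
      norm_num
    rw [h1]
    have h2 : ‖x‖ ^ 2 ≤ (2 * R) ^ 2 := pow_le_pow_left₀ (norm_nonneg _) hx' 2
    have hA : 2 * Real.exp s * ‖x‖ ^ 2 ≤ 2 * Real.exp s * (2 * R) ^ 2 :=
      mul_le_mul_of_nonneg_left h2 (by positivity)
    have hB : 11 * R ^ 2 * Real.exp s * (15 / 16) ≤
        11 * R ^ 2 * Real.exp s * ‖drivingPt lam s - Real.exp s * x‖ :=
      mul_le_mul_of_nonneg_left hd (by positivity)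
    have hP : 0 ≤ R ^ 2 * Real.exp s := by positivity
    nlinarith [hA, hB, hP]
  · -- Lipschitz
    intro s hs x hx y hy
    have hx' : ‖x‖ ≤ 2 * R := mem_closedBall_zero_iff.1 hx
    have hy' : ‖y‖ ≤ 2 * R := mem_closedBall_zero_iff.1 hy
    have hdx := hden s hs x hx
    have hdy := hden s hs y hy
    have hexy : Real.exp s * ‖x‖ ≤ 1 / 16 := exp_mul_norm_le hT hs hx'
    have hmid : ‖drivingPt lam s * (x + y) - Real.exp s * x * y‖ ≤ 33 / 8 * R := by
      have e1 : ‖drivingPt lam s * (x + y)‖ ≤ 4 * R := by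
        rw [norm_mul, norm_drivingPt, one_mul]
        exact (norm_add_le _ _).trans (by linarith)
      have e2 : ‖(Real.exp s : ℂ) * x * y‖ ≤ 1 / 16 * (2 * R) := by
        rw [norm_mul, WholePlaneLoewnerChain.norm_ofReal_exp_mul]
        exact mul_le_mul hexy hy' (norm_nonneg _) (by norm_num)
      calc ‖drivingPt lam s * (x + y) - Real.exp s * x * y‖
          ≤ ‖drivingPt lam s * (x + y)‖ + ‖(Real.exp s : ℂ) * x * y‖ := norm_sub_le _ _
        _ ≤ 4 * R + 1 / 16 * (2 * R) := add_le_add e1 e2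
        _ = 33 / 8 * R := by ring
    have hprod : (15 / 16) * (15 / 16) ≤
        ‖drivingPt lam s - Real.exp s * x‖ * ‖drivingPt lam s - Real.exp s * y‖ :=
      mul_le_mul hdx hdy (by norm_num) (by linarith)
    rw [kernel_sub_kernel (hden0 s hs x hx) (hden0 s hs y hy), norm_div, norm_mul, norm_mul,
      norm_mul, norm_mul, div_le_iff₀ (mul_pos (by linarith) (by linarith))]
    have e2 : ‖(2 : ℂ)‖ = 2 := by norm_num
    have ee : ‖(Real.exp s : ℂ)‖ = Real.exp s := Complex.norm_of_nonneg (Real.exp_pos s).le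
    rw [e2, ee]
    have hA : 2 * Real.exp s * ‖x - y‖ * ‖drivingPt lam s * (x + y) - Real.exp s * x * y‖ ≤
        2 * Real.exp s * ‖x - y‖ * (33 / 8 * R) :=
      mul_le_mul_of_nonneg_left hmid (by positivity)
    have hB : 18 * R * Real.exp s * ‖x - y‖ * ((15 / 16) * (15 / 16)) ≤
        18 * R * Real.exp s * ‖x - y‖ *
          (‖drivingPt lam s - Real.exp s * x‖ * ‖drivingPt lam s - Real.exp s * y‖) :=
      mul_le_mul_of_nonneg_left hprod (by positivity)
    have hP : 0 ≤ R * Real.exp s * ‖x - y‖ := by positivity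
    nlinarith [hA, hB, hP]

/-! ### Existence of trajectories near `-∞` -/

/-- `e^{-t} (eᵗ m) = m` in `ℂ`. [folklore] -/
theorem exp_neg_mul_exp_mul (t : ℝ) (m : ℂ) :
    (Real.exp (-t) : ℂ) * ((Real.exp t : ℂ) * m) = m := by
  rw [← mul_assoc, ← ofReal_mul, Real.exp_neg, inv_mul_cancel₀ (Real.exp_pos t).ne', ofReal_one,
    one_mul]

/-- **From a Volterra solution to a trajectory.** If `m` solves the Volterra equation of the kernel
on `(-∞, T₁]` with values in `closedBall 0 (2R)`, `T₁ ≤ T₀`, `32 (R + 1) e^{T₀} ≤ 1`, then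
`k = eᵗ m` is a trajectory of `w` with lifetime `T₁`. [folklore] -/
theorem isTraj_of_isVolterraSol (hlam : Continuous lam) {R T₀ T₁ : ℝ} {w : ℂ} {m : ℝ → ℂ}
    (hR : 0 ≤ R) (hT : 32 * (R + 1) * Real.exp T₀ ≤ 1) (hT₁ : T₁ ≤ T₀)
    (hm : IsVolterraSol T₁ (closedBall (0 : ℂ) (2 * R)) w (kernel lam) m) :
    IsTraj lam w (fun t ↦ (Real.exp t : ℂ) * m t) T₁ := by
  have hV := kernel_volterraData hlam hR hT
  refine ⟨fun t ht ↦ ?_, fun t ht ↦ ?_, ?_⟩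
  · have ht' : t < T₁ := EReal.coe_lt_coe_iff.1 ht
    have hmt : ‖m t‖ ≤ 2 * R := mem_closedBall_zero_iff.1 (hm.mem ht'.le)
    have hsmall := exp_mul_norm_le hT (ht'.le.trans hT₁) hmt
    have hden : drivingPt lam t - Real.exp t * m t ≠ 0 := fun h0 ↦ by
      have := sub_le_norm_drivingPt_sub (lam := lam) hsmall
      rw [h0, norm_zero] at this
      linarith
    have h1 : HasDerivAt m (kernel lam t (m t)) t := hm.hasDerivAt hV hT₁ ht'
    have h2 : HasDerivAt (fun t ↦ (Real.exp t : ℂ)) (Real.exp t : ℂ) t :=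
      (Real.hasDerivAt_exp t).ofReal_comp
    have h3 := h2.mul h1
    exact h3.congr_deriv (dfield_exp_mul t (m t) hden).symm
  · have ht' : t < T₁ := EReal.coe_lt_coe_iff.1 ht
    have hmt : ‖m t‖ ≤ 2 * R := mem_closedBall_zero_iff.1 (hm.mem ht'.le)
    have := exp_mul_norm_le hT (ht'.le.trans hT₁) hmt
    show ‖(Real.exp t : ℂ) * m t‖ < 1
    rw [WholePlaneLoewnerChain.norm_ofReal_exp_mul]
    linarith
  · show Tendsto (fun t : ℝ ↦ (Real.exp (-t) : ℂ) * ((Real.exp t : ℂ) * m t)) atBot (𝓝 w)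
    simp only [exp_neg_mul_exp_mul]
    exact hm.tendsto_atBot hV hT₁

/-- **Existence of trajectories near `-∞`** (continuous driving function): if
`32 (‖w‖ + 1) e^{T₀} ≤ 1` then `w` has a trajectory with lifetime `T₀`, of the form `k = eᵗ m`
with `m` the Volterra solution started at `-∞` from `w`, `‖m t - w‖ ≤ 11 ‖w‖² eᵗ`.
Lawler (2005), Prop. 4.21 (existence). [cite: Lawler2005, Prop. 4.21] -/
theorem exists_isTraj (hlam : Continuous lam) (w : ℂ) {T₀ : ℝ}
    (hT : 32 * (‖w‖ + 1) * Real.exp T₀ ≤ 1) :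
    ∃ m : ℝ → ℂ, IsVolterraSol T₀ (closedBall (0 : ℂ) (2 * ‖w‖)) w (kernel lam) m ∧
      (∀ t ≤ T₀, ‖m t - w‖ ≤ 11 * ‖w‖ ^ 2 * Real.exp t) ∧
      IsTraj lam w (fun t ↦ (Real.exp t : ℂ) * m t) T₀ := by
  have hV := kernel_volterraData hlam (norm_nonneg w) hT
  have hS : closedBall w ‖w‖ ⊆ closedBall (0 : ℂ) (2 * ‖w‖) := by
    intro x hx
    rw [mem_closedBall, dist_eq_norm] at hx
    rw [mem_closedBall_zero_iff]
    calc ‖x‖ = ‖(x - w) + w‖ := by rw [sub_add_cancel]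
      _ ≤ ‖x - w‖ + ‖w‖ := norm_add_le _ _
      _ ≤ 2 * ‖w‖ := by linarith
  have hBρ : 11 * ‖w‖ ^ 2 * Real.exp T₀ ≤ ‖w‖ := by
    have h0 := norm_nonneg w
    have : 11 * ‖w‖ * Real.exp T₀ ≤ 1 := by nlinarith [Real.exp_pos T₀]
    nlinarith
  have hL : 18 * ‖w‖ * Real.exp T₀ < 1 := by nlinarith [Real.exp_pos T₀, norm_nonneg w]
  obtain ⟨m, hm, -⟩ := hV.exists_isVolterraSol hS hBρ hL
  exact ⟨m, hm, fun t ht ↦ hm.norm_sub_le_of_le hV le_rfl ht,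
    isTraj_of_isVolterraSol hlam (norm_nonneg w) hT le_rfl hm⟩

/-- A sufficiently early time lies (weakly) before the lifetime: `T₀ ≤ lifetime λ w` whenever
`32 (‖w‖ + 1) e^{T₀} ≤ 1`. [folklore] -/
theorem coe_le_lifetime (hlam : Continuous lam) (w : ℂ) {T₀ : ℝ}
    (hT : 32 * (‖w‖ + 1) * Real.exp T₀ ≤ 1) : (T₀ : EReal) ≤ lifetime lam w := by
  obtain ⟨m, -, -, hk⟩ := exists_isTraj hlam w hT
  exact hk.le_lifetime

/-- A convenient early time: `T = -log (32 (‖w‖ + 1))` satisfies `32 (‖w‖ + 1) e^{T} = 1`. [folklore] -/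
theorem exp_neg_log_mul (w : ℂ) : 32 * (‖w‖ + 1) * Real.exp (-Real.log (32 * (‖w‖ + 1))) = 1 := by
  have h : 0 < 32 * (‖w‖ + 1) := by positivity
  rw [Real.exp_neg, Real.exp_log h, mul_inv_cancel₀ h.ne']

/-- **Every point has a trajectory**: `⊥ < lifetime λ w` (continuous driving function). [folklore] -/
theorem bot_lt_lifetime (hlam : Continuous lam) (w : ℂ) : ⊥ < lifetime lam w :=
  lt_of_lt_of_le (EReal.bot_lt_coe _) (coe_le_lifetime hlam w (exp_neg_log_mul w).le)

/-- A time `t` with `32 (‖w‖ + 1) eᵗ < 1` is before the canonical early time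
`-log (32 (‖w‖ + 1))`. [folklore] -/
theorem lt_neg_log_of_lt (w : ℂ) {t : ℝ} (ht : 32 * (‖w‖ + 1) * Real.exp t < 1) :
    t < -Real.log (32 * (‖w‖ + 1)) := by
  by_contra hle
  push Not at hle
  have h1 : Real.exp (-Real.log (32 * (‖w‖ + 1))) ≤ Real.exp t := Real.exp_le_exp.2 hle
  have h2 : 32 * (‖w‖ + 1) * Real.exp (-Real.log (32 * (‖w‖ + 1))) ≤
      32 * (‖w‖ + 1) * Real.exp t := mul_le_mul_of_nonneg_left h1 (by positivity)
  rw [exp_neg_log_mul] at h2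
  linarith

/-- A time `t` with `32 (‖w‖ + 1) eᵗ < 1` is strictly before the lifetime of `w`. [folklore] -/
theorem coe_lt_lifetime (hlam : Continuous lam) (w : ℂ) {t : ℝ}
    (ht : 32 * (‖w‖ + 1) * Real.exp t < 1) : (t : EReal) < lifetime lam w :=
  lt_of_lt_of_le (EReal.coe_lt_coe_iff.2 (lt_neg_log_of_lt w ht))
    (coe_le_lifetime hlam w (exp_neg_log_mul w).le)

/-! ### From a trajectory back to the Volterra equation; uniqueness -/

section Uniqueness

variable {w : ℂ} {k k' : ℝ → ℂ} {T T' : EReal}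

/-- Along a trajectory, `n = e^{-t} k` solves `ṅ = kernel λ t n` before the lifetime. [folklore] -/
theorem IsTraj.hasDerivAt_exp_neg_mul (h : IsTraj lam w k T) {t : ℝ} (ht : (t : EReal) < T) :
    HasDerivAt (fun s ↦ (Real.exp (-s) : ℂ) * k s)
      (kernel lam t ((Real.exp (-t) : ℂ) * k t)) t := by
  have hk := h.hasDerivAt ht
  have he : HasDerivAt (fun s ↦ (Real.exp (-s) : ℂ)) (-(Real.exp (-t) : ℂ)) t := by
    have := ((Real.hasDerivAt_exp (-t)).comp t (hasDerivAt_neg t)).ofReal_comp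
    simpa using this
  have hprod := he.mul hk
  -- identify the derivative through `dfield_exp_mul` with `m = e^{-t} k t`
  have hkt : k t = (Real.exp t : ℂ) * ((Real.exp (-t) : ℂ) * k t) := by
    rw [← mul_assoc, ← ofReal_mul, ← Real.exp_add, add_neg_cancel, Real.exp_zero, ofReal_one,
      one_mul]
  have hden : drivingPt lam t - Real.exp t * ((Real.exp (-t) : ℂ) * k t) ≠ 0 := by
    rw [← hkt, sub_ne_zero]
    exact (h.ne_drivingPt ht).symm
  have hid := dfield_exp_mul t ((Real.exp (-t) : ℂ) * k t) hden
  rw [← hkt] at hid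
  refine hprod.congr_deriv ?_
  rw [hid]
  have h1 : (Real.exp (-t) : ℂ) * (Real.exp t : ℂ) = 1 := by
    rw [← ofReal_mul, Real.exp_neg, inv_mul_cancel₀ (Real.exp_pos t).ne', ofReal_one]
  linear_combination (kernel lam t ((Real.exp (-t) : ℂ) * k t)) * h1

/-- **A trajectory solves the Volterra equation far in the past**: if `k` is a trajectory of `w`,
then for every `T₁` before the lifetime with `32 (‖w‖ + 2) e^{T₁} ≤ 1` and such that
`‖e^{-t} k t - w‖ ≤ 1` for all `t ≤ T₁`, the function `e^{-t} k t` is a Volterra solution of the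
kernel on `(-∞, T₁]` with values in `closedBall 0 (2 (‖w‖ + 1))`. [folklore] -/
theorem IsTraj.isVolterraSol (hlam : Continuous lam) (h : IsTraj lam w k T) {T₁ : ℝ}
    (hT₁ : (T₁ : EReal) < T) (hsmall : 32 * ((‖w‖ + 1) + 1) * Real.exp T₁ ≤ 1)
    (hnear : ∀ t ≤ T₁, ‖(Real.exp (-t) : ℂ) * k t - w‖ ≤ 1) :
    IsVolterraSol T₁ (closedBall (0 : ℂ) (2 * (‖w‖ + 1))) w (kernel lam)
      (fun t ↦ (Real.exp (-t) : ℂ) * k t) := by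
  have hV := kernel_volterraData hlam (by positivity) hsmall
  refine isVolterraSol_of_hasDerivAt hV le_rfl (fun t ht ↦ ?_) (fun t ht ↦ ?_) h.tendsto
  · exact h.hasDerivAt_exp_neg_mul (lt_of_le_of_lt (EReal.coe_le_coe_iff.2 ht) hT₁)
  · rw [mem_closedBall_zero_iff]
    have := hnear t ht
    calc ‖(Real.exp (-t) : ℂ) * k t‖ = ‖((Real.exp (-t) : ℂ) * k t - w) + w‖ := by
          rw [sub_add_cancel]
      _ ≤ ‖(Real.exp (-t) : ℂ) * k t - w‖ + ‖w‖ := norm_add_le _ _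
      _ ≤ 2 * (‖w‖ + 1) := by linarith [norm_nonneg w]

/-- Along a trajectory, `e^{-t} k t` is eventually (as `t → -∞`) within distance `1` of `w`,
uniformly on a ray `(-∞, T₂]`. [folklore] -/
theorem IsTraj.exists_forall_norm_sub_le (h : IsTraj lam w k T) :
    ∃ T₂ : ℝ, ∀ t ≤ T₂, ‖(Real.exp (-t) : ℂ) * k t - w‖ ≤ 1 := by
  have h1 : ∀ᶠ t in atBot, ‖(Real.exp (-t) : ℂ) * k t - w‖ ≤ 1 := by
    have := (tendsto_iff_norm_sub_tendsto_zero.1 h.tendsto).eventually (Iic_mem_nhds one_pos)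
    filter_upwards [this] with t ht using ht
  obtain ⟨T₂, hT₂⟩ := eventually_atBot.1 h1
  exact ⟨T₂, hT₂⟩

/-- **The bridge to the radial Loewner chain**: a trajectory, restarted at a time `b` before its
lifetime and followed up to a real time `c ≤ T`, is a solution of the radial Loewner equation of
`RadialLoewnerChain` for the shifted driver `u ↦ -λ(b + u)` started at `k b` with lifetime
`c - b` (vacuous if `c ≤ b`). [folklore] -/
theorem IsTraj.disc_isSolution (h : IsTraj lam w k T) {b c : ℝ} (hc : (c : EReal) ≤ T) :
    RadialLoewner.Disc.IsSolution (shiftDriver lam b) (k b) (fun u ↦ k (b + u))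
      ((c - b).toNNReal : ℝ≥0) := by
  have hdom : ∀ u : ℝ, u ∈ RadialLoewner.Disc.timeDom ((c - b).toNNReal : ℝ≥0) ↔ 0 ≤ u ∧ u < c - b := by
    intro u
    simp only [RadialLoewner.Disc.timeDom, mem_setOf_eq, WithTop.coe_lt_coe]
    constructor
    · rintro ⟨hu0, hu⟩
      exact ⟨hu0, (Real.toNNReal_lt_toNNReal_iff_of_nonneg hu0).1 hu⟩
    · rintro ⟨hu0, hu⟩
      exact ⟨hu0, (Real.toNNReal_lt_toNNReal_iff_of_nonneg hu0).2 hu⟩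
  have hlt : ∀ u : ℝ, 0 ≤ u → u < c - b → ((b + u : ℝ) : EReal) < T := fun u _ hu ↦
    lt_of_lt_of_le (EReal.coe_lt_coe_iff.2 (by linarith)) hc
  refine ⟨by simp, fun u hu ↦ ?_, fun u hu0 hu ↦ ?_⟩
  · rw [hdom] at hu
    have h1 := h.hasDerivAt (hlt u hu.1 hu.2)
    have h2 : HasDerivAt (fun u : ℝ ↦ k (b + u)) (dfield lam (b + u) (k (b + u))) u :=
      h1.comp_const_add b u
    rw [dfield_eq_disc_field b hu.1] at h2
    exact h2.hasDerivWithinAt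
  · have hu' : u < c - b := ((hdom u).1 ⟨hu0, hu⟩).2
    rw [disc_drivingPt_shiftDriver b hu0]
    exact h.ne_drivingPt (hlt u hu0 hu')

/-- **Uniqueness of trajectories**: two trajectories of the same point agree at every real time
before both lifetimes (continuous driving function). Far in the past both `e^{-t} k`, `e^{-t} k'`
solve the same Volterra equation in the same ball, hence agree (`IsVolterraSol.eqOn`); afterwards
they solve the radial Loewner equation of the shifted driver from the same point, hence agree
(`RadialLoewner.Disc.IsSolution.eqOn`). Lawler (2005), Prop. 4.21 (uniqueness).
[cite: Lawler2005, Prop. 4.21] -/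
theorem IsTraj.eq_of_isTraj (hlam : Continuous lam) (h : IsTraj lam w k T) (h' : IsTraj lam w k' T')
    {t : ℝ} (ht : (t : EReal) < T) (ht' : (t : EReal) < T') : k t = k' t := by
  -- a common early time `T₁`
  obtain ⟨T₂, hT₂⟩ := h.exists_forall_norm_sub_le
  obtain ⟨T₂', hT₂'⟩ := h'.exists_forall_norm_sub_le
  set Tw : ℝ := -Real.log (32 * ((‖w‖ + 1) + 1)) with hTw
  have hTw1 : 32 * ((‖w‖ + 1) + 1) * Real.exp Tw = 1 := by
    have hpos : 0 < 32 * ((‖w‖ + 1) + 1) := by positivity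
    rw [hTw, Real.exp_neg, Real.exp_log hpos, mul_inv_cancel₀ hpos.ne']
  set T₁ : ℝ := min (min T₂ T₂') (min Tw (t - 1)) with hT₁
  have hT₁₂ : T₁ ≤ T₂ := (min_le_left _ _).trans (min_le_left _ _)
  have hT₁₂' : T₁ ≤ T₂' := (min_le_left _ _).trans (min_le_right _ _)
  have hT₁w : T₁ ≤ Tw := (min_le_right _ _).trans (min_le_left _ _)
  have hT₁t : T₁ < t := by
    have : T₁ ≤ t - 1 := (min_le_right _ _).trans (min_le_right _ _)
    linarith
  have hT₁T : (T₁ : EReal) < T := lt_trans (EReal.coe_lt_coe_iff.2 hT₁t) ht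
  have hT₁T' : (T₁ : EReal) < T' := lt_trans (EReal.coe_lt_coe_iff.2 hT₁t) ht'
  have hsmall : 32 * ((‖w‖ + 1) + 1) * Real.exp T₁ ≤ 1 := by
    calc 32 * ((‖w‖ + 1) + 1) * Real.exp T₁ ≤ 32 * ((‖w‖ + 1) + 1) * Real.exp Tw := by
          gcongr
      _ = 1 := hTw1
  -- Volterra uniqueness on `(-∞, T₁]`
  have hV := kernel_volterraData hlam (by positivity) hsmall
  have hs := h.isVolterraSol hlam hT₁T hsmall fun s hs ↦ hT₂ s (hs.trans hT₁₂)
  have hs' := h'.isVolterraSol hlam hT₁T' hsmall fun s hs ↦ hT₂' s (hs.trans hT₁₂')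
  have hL : 18 * (‖w‖ + 1) * Real.exp T₁ < 1 := by nlinarith [Real.exp_pos T₁, norm_nonneg w]
  have hpast : ∀ s ≤ T₁, k s = k' s := by
    intro s hs₁
    have e : (Real.exp (-s) : ℂ) * k s = (Real.exp (-s) : ℂ) * k' s := hs.eqOn hs' hV le_rfl hL hs₁
    have he : (Real.exp (-s) : ℂ) ≠ 0 := ofReal_ne_zero.2 (Real.exp_pos _).ne'
    exact mul_left_cancel₀ he e
  -- radial uniqueness on `[T₁, t]`: a real time `c` with `t < c ≤ min T T'`
  obtain ⟨c, htc, hcT⟩ := EReal.lt_iff_exists_real_btwn.1 (lt_min ht ht')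
  have htc' : t < c := EReal.coe_lt_coe_iff.1 htc
  have hcT₁ : T₁ ≤ c := (hT₁t.trans htc').le
  have hd := h.disc_isSolution (b := T₁) (hcT.le.trans (min_le_left _ _))
  have hd' := h'.disc_isSolution (b := T₁) (hcT.le.trans (min_le_right _ _))
  rw [← hpast T₁ le_rfl] at hd'
  have hmem : t - T₁ ∈ RadialLoewner.Disc.timeDom
      (min (((c - T₁).toNNReal : ℝ≥0) : WithTop ℝ≥0) (((c - T₁).toNNReal : ℝ≥0) : WithTop ℝ≥0)) := by
    rw [min_self]
    refine ⟨by linarith, ?_⟩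
    rw [WithTop.coe_lt_coe]
    exact (Real.toNNReal_lt_toNNReal_iff_of_nonneg (by linarith)).2 (by linarith)
  have := RadialLoewner.Disc.IsSolution.eqOn (continuous_shiftDriver hlam T₁) hd hd' hmem
  simpa using this

end Uniqueness

/-! ### The maximal trajectory -/

section Maximal

variable {w : ℂ} {k : ℝ → ℂ} {T : EReal}

/-- **The maximal trajectory evaluates every trajectory**: `traj λ w t = k t` for every trajectory
`k` of `w` alive at `t` (continuous driving function). [folklore] -/
theorem traj_eq (hlam : Continuous lam) (h : IsTraj lam w k T) {t : ℝ} (ht : (t : EReal) < T) :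
    traj lam w t = k t := by
  classical
  have hex : ∃ p : (ℝ → ℂ) × EReal, IsTraj lam w p.1 p.2 ∧ (t : EReal) < p.2 := ⟨(k, T), h, ht⟩
  rw [traj, dif_pos hex]
  exact hex.choose_spec.1.eq_of_isTraj hlam h hex.choose_spec.2 ht

/-- Before the lifetime of `w` some trajectory of `w` is alive. [folklore] -/
theorem exists_isTraj_of_lt_lifetime {t : EReal} (ht : t < lifetime lam w) :
    ∃ k T, IsTraj lam w k T ∧ t < T := by
  obtain ⟨T, ⟨k, hk⟩, htT⟩ := lt_sSup_iff.1 ht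
  exact ⟨k, T, hk, htT⟩

/-- **The maximal trajectory is a trajectory with lifetime `lifetime λ w`** (continuous driving
function): patch the trajectories alive at each time, which agree by uniqueness. [folklore] -/
theorem isTraj_traj (hlam : Continuous lam) (w : ℂ) : IsTraj lam w (traj lam w) (lifetime lam w) := by
  -- near each `t < lifetime`, `traj` agrees with a trajectory alive beyond `t`
  have hloc : ∀ t : ℝ, (t : EReal) < lifetime lam w →
      ∃ k T, IsTraj lam w k T ∧ (t : EReal) < T ∧ traj lam w =ᶠ[𝓝 t] k := by
    intro t ht
    obtain ⟨k, T, hk, htT⟩ := exists_isTraj_of_lt_lifetime ht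
    obtain ⟨c, htc, hcT⟩ := EReal.lt_iff_exists_real_btwn.1 htT
    refine ⟨k, T, hk, htT, ?_⟩
    filter_upwards [Iio_mem_nhds (EReal.coe_lt_coe_iff.1 htc)] with s hs
    exact traj_eq hlam hk (lt_trans (EReal.coe_lt_coe_iff.2 hs) hcT)
  refine ⟨fun t ht ↦ ?_, fun t ht ↦ ?_, ?_⟩
  · obtain ⟨k, T, hk, htT, hev⟩ := hloc t ht
    rw [hev.self_of_nhds]
    exact (hk.hasDerivAt htT).congr_of_eventuallyEq hev
  · obtain ⟨k, T, hk, htT, hev⟩ := hloc t ht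
    rw [hev.self_of_nhds]
    exact hk.norm_lt_one htT
  · -- far in the past `traj` agrees with the trajectory of `exists_isTraj`
    obtain ⟨m, -, -, hk⟩ := exists_isTraj hlam w (exp_neg_log_mul w).le
    refine hk.tendsto.congr' ?_
    filter_upwards [eventually_lt_atBot (-Real.log (32 * (‖w‖ + 1)))] with t ht
    rw [traj_eq hlam hk (EReal.coe_lt_coe_iff.2 ht)]

/-- **Every trajectory is a restriction of the maximal one.** [folklore] -/
theorem IsTraj.eqOn_traj (hlam : Continuous lam) (h : IsTraj lam w k T) {t : ℝ} (ht : (t : EReal) < T) :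
    k t = traj lam w t :=
  (traj_eq hlam h ht).symm

/-- The maximal trajectory of `0` is the constant `0`. [folklore] -/
theorem traj_zero (hlam : Continuous lam) (t : ℝ) : traj lam 0 t = 0 :=
  traj_eq hlam isTraj_zero (EReal.coe_lt_top t)

/-- **The a priori bound near `-∞`**: `‖e^{-t} traj λ w t - w‖ ≤ 11 ‖w‖² eᵗ` whenever
`32 (‖w‖ + 1) eᵗ < 1`; in particular `traj λ w t = eᵗ w + O(‖w‖² e^{2t})`. [folklore] -/
theorem norm_traj_sub_le (hlam : Continuous lam) (w : ℂ) {t : ℝ}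
    (ht : 32 * (‖w‖ + 1) * Real.exp t < 1) :
    ‖(Real.exp (-t) : ℂ) * traj lam w t - w‖ ≤ 11 * ‖w‖ ^ 2 * Real.exp t := by
  have htT := lt_neg_log_of_lt w ht
  obtain ⟨m, -, hbd, hk⟩ := exists_isTraj hlam w (exp_neg_log_mul w).le
  rw [traj_eq hlam hk (EReal.coe_lt_coe_iff.2 htT), exp_neg_mul_exp_mul]
  exact hbd t htT.le

/-- Near `-∞` the maximal trajectory is small: `‖traj λ w t‖ ≤ 2 ‖w‖ eᵗ` whenever
`32 (‖w‖ + 1) eᵗ < 1`. [folklore] -/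
theorem norm_traj_le (hlam : Continuous lam) (w : ℂ) {t : ℝ}
    (ht : 32 * (‖w‖ + 1) * Real.exp t < 1) : ‖traj lam w t‖ ≤ 2 * ‖w‖ * Real.exp t := by
  have h1 := norm_traj_sub_le hlam w ht
  have h2 : ‖(Real.exp (-t) : ℂ) * traj lam w t‖ ≤ ‖w‖ + 11 * ‖w‖ ^ 2 * Real.exp t := by
    calc ‖(Real.exp (-t) : ℂ) * traj lam w t‖
        = ‖((Real.exp (-t) : ℂ) * traj lam w t - w) + w‖ := by rw [sub_add_cancel]
      _ ≤ ‖(Real.exp (-t) : ℂ) * traj lam w t - w‖ + ‖w‖ := norm_add_le _ _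
      _ ≤ ‖w‖ + 11 * ‖w‖ ^ 2 * Real.exp t := by linarith
  rw [WholePlaneLoewnerChain.norm_ofReal_exp_mul] at h2
  have h3 : 11 * ‖w‖ * Real.exp t ≤ 1 := by nlinarith [Real.exp_pos t, norm_nonneg w]
  have h4 : Real.exp (-t) * ‖traj lam w t‖ ≤ 2 * ‖w‖ := by nlinarith [norm_nonneg w]
  have h5 := mul_le_mul_of_nonneg_left h4 (Real.exp_pos t).le
  rw [← mul_assoc, ← Real.exp_add, add_neg_cancel, Real.exp_zero, one_mul] at h5
  linarith

end Maximal

end WholePlaneLoewner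

end Literature.Probability.RandomPlanarGeometry
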